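import Mathlib
import Summits.ABC.ABC.Theses.ThreeSlotCyclotomicDescent
import Summits.ABC.ABC.Theorems.ThreeSlotShapes
import Summits.ABC.ABC.Theorems.ThreeSlotOneSlotPrimePow
import Summits.ABC.ABC.Theorems.ThreeSlotOneSlotComposite
import Summits.ABC.ABC.Theorems.ThreeSlotThreePPRest

/-!
# `ThreeSlotCyclotomicDescent.ZooSorting` (stmt-ABC-24024) holds

The ε-free SORTING of the non-rigid three-prime cell: every abc triple with `ω(abc) ≤ 3` that is not
rigid (not: `a, b ≥ 2` with pairwise coprime prime-power exponents) satisfies `c ≤ 5 · rad(abc)`, or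
lies (up to `a ↔ b`) in one of the solved-in-print families L1–L4 or one of the wall families W1, W1b,
W2a, W2b, W3, W4 of `route-ABC-ThreeSlotCyclotomicDescent`.

This file is the ASSEMBLY of the registered birth skeleton (`ZooSorting_of`, four stubs), each stub
now a theorem in the tree:

* stub 1 `stub_oneSlot_primePow`    — `ThreeSlotOneSlotPrimePow.oneSlot_primePow` (p591666);
* stub 2 `stub_oneSlot_notPrimePow` — `ThreeSlotOneSlotComposite.oneSlot_composite` (p591397);
* stub 3 `stub_threePP_evenPair`    — `ThreeSlotShapes.evenPair_le_two_rad` (p590067, constant `2`);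
* stub 4 `stub_threePP_rest`        — `ThreeSlotThreePPRest.threePP_rest` (p592021).

The case split is the skeleton's: `a = 1` (prime-power `c` / composite `c`), `b = 1` (the same two
stubs on the swapped triple, landing in the mirrored family slots; `rad_swap`), and `a, b ≥ 2` (even
pair through the exponent of `c` / the rest).  A structure theorem for the cell B₃ of the ω-split
cover — legibility, not distance: no summit, rung or conjunct of abc is proved here.
-/

-- `Summit.<Summit>.<Problem>` is the mandated summit-side namespace (CONVENTIONS §2); for the
-- single-conjunct summit `ABC` the two coincide, so the duplicate `ABC.ABC` is deliberate.
set_option linter.dupNamespace false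

namespace Summit.ABC.ABC.Theorems

open Literature.NumberTheory.DiophantineGeometry (IsABCTriple rad rad_swap)
open Summit.ABC.ABC.Theorems.ThreeSlotShapes (evenPair_le_two_rad)
open Summit.ABC.ABC.Theorems.ThreeSlotOneSlotPrimePow (oneSlot_primePow)
open Summit.ABC.ABC.Theorems.ThreeSlotOneSlotComposite (oneSlot_composite)
open Summit.ABC.ABC.Theorems.ThreeSlotThreePPRest (threePP_rest)

/-- **`ZooSorting` (stmt-ABC-24024, crux of `route-ABC-ThreeSlotCyclotomicDescent`) holds**: every
non-rigid abc triple with `ω(abc) ≤ 3` has `c ≤ 5 · rad(abc)` or lies, up to `a ↔ b`, in one of the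
families L1–L4, W1, W1b, W2a, W2b, W3, W4 of the route statement.  Assembly of the four birth stubs
(see the module docstring). [folklore; Zsigmondy 1892, Mihăilescu 2004, Euler (FLT₃) as used in the
stub files] -/
theorem zooSorting_proof : Summit.ABC.ABC.Theses.ThreeSlotCyclotomicDescent.ZooSorting := by
  unfold Summit.ABC.ABC.Theses.ThreeSlotCyclotomicDescent.ZooSorting
  intro a b c ht hω hnr
  have ha : 0 < a := ht.1
  have hb : 0 < b := ht.2.1
  by_cases ha1 : a = 1
  · -- one-slot triples `1 + b = c`
    subst ha1
    by_cases hpc : IsPrimePow c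
    · rcases oneSlot_primePow b c ht hω hpc with h | ⟨x, q, r, z, hq, hr, hro, hzo, hz, hb', hc'⟩ |
          ⟨x, y, q, r, z, hq, hr, hro, hzo, hz, hy, hb', hc'⟩ |
          ⟨x, y, z, p, q, hp, hq, hpq, hx, hy, hzo, hz, hb', hc'⟩
      · exact Or.inl h
      · -- L3
        exact Or.inr (Or.inl (Or.inl (Or.inr (Or.inr (Or.inl
          ⟨x, q, r, z, hq, hr, hro, hzo, hz, rfl, hb', hc'⟩)))))
      · -- W1
        exact Or.inr (Or.inr (Or.inl (Or.inl ⟨x, y, q, r, z, hq, hr, hro, hzo, hz, hy, rfl, hb', hc'⟩)))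
      · -- W2a
        exact Or.inr (Or.inr (Or.inl (Or.inr (Or.inr (Or.inl
          ⟨x, y, z, p, q, hp, hq, hpq, hx, hy, hzo, hz, rfl, hb', hc'⟩)))))
    · rcases oneSlot_composite b c ht hω hpc with h | ⟨x, y, z, p, q, hp, hq, hpq, hm, hb', hc'⟩ |
          ⟨x, y, p, r, z, hp, hr, hpo, hxo, hx, hy, hz, hb', hc'⟩ | ⟨u, p, r, z, hp, hr, hu, hb', hc', hz⟩ |
          ⟨u, p, r, z, hp, hr, hu, hz, hze, hb', hc'⟩
      · exact Or.inl h
      · -- W2b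
        exact Or.inr (Or.inr (Or.inl (Or.inr (Or.inr (Or.inr (Or.inl
          ⟨x, y, z, p, q, hp, hq, hpq, hm, rfl, hb', hc'⟩))))))
      · -- W1b
        exact Or.inr (Or.inr (Or.inl (Or.inr (Or.inl
          ⟨x, y, p, r, z, hp, hr, hpo, hxo, hx, hy, hz, rfl, hb', hc'⟩))))
      · -- W4
        exact Or.inr (Or.inr (Or.inl (Or.inr (Or.inr (Or.inr (Or.inr (Or.inr
          ⟨u, p, r, z, hp, hr, hu, rfl, hb', hc', hz⟩)))))))
      · -- L2
        exact Or.inr (Or.inl (Or.inl (Or.inr (Or.inl ⟨u, p, r, z, hp, hr, hu, hz, hze, rfl, hb', hc'⟩))))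
  by_cases hb1 : b = 1
  · -- one-slot triples `a + 1 = c`: the same stubs on the swapped triple, mirrored slots
    subst hb1
    have hts : IsABCTriple 1 a c := ht.swap
    have hω' : (1 * a * c).primeFactors.card ≤ 3 := by simpa [mul_comm] using hω
    have hrs : rad 1 a c = rad a 1 c := rad_swap a 1 c
    by_cases hpc : IsPrimePow c
    · rcases oneSlot_primePow a c hts hω' hpc with h | ⟨x, q, r, z, hq, hr, hro, hzo, hz, ha', hc'⟩ |
          ⟨x, y, q, r, z, hq, hr, hro, hzo, hz, hy, ha', hc'⟩ |
          ⟨x, y, z, p, q, hp, hq, hpq, hx, hy, hzo, hz, ha', hc'⟩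
      · left; rwa [hrs] at h
      · -- L3'
        exact Or.inr (Or.inl (Or.inr (Or.inr (Or.inr (Or.inl
          ⟨x, q, r, z, hq, hr, hro, hzo, hz, rfl, ha', hc'⟩)))))
      · -- W1'
        exact Or.inr (Or.inr (Or.inr (Or.inl ⟨x, y, q, r, z, hq, hr, hro, hzo, hz, hy, rfl, ha', hc'⟩)))
      · -- W2a'
        exact Or.inr (Or.inr (Or.inr (Or.inr (Or.inr (Or.inl
          ⟨x, y, z, p, q, hp, hq, hpq, hx, hy, hzo, hz, rfl, ha', hc'⟩)))))
    · rcases oneSlot_composite a c hts hω' hpc with h | ⟨x, y, z, p, q, hp, hq, hpq, hm, ha', hc'⟩ |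
          ⟨x, y, p, r, z, hp, hr, hpo, hxo, hx, hy, hz, ha', hc'⟩ | ⟨u, p, r, z, hp, hr, hu, ha', hc', hz⟩ |
          ⟨u, p, r, z, hp, hr, hu, hz, hze, ha', hc'⟩
      · left; rwa [hrs] at h
      · -- W2b'
        exact Or.inr (Or.inr (Or.inr (Or.inr (Or.inr (Or.inr (Or.inl
          ⟨x, y, z, p, q, hp, hq, hpq, hm, rfl, ha', hc'⟩))))))
      · -- W1b'
        exact Or.inr (Or.inr (Or.inr (Or.inr (Or.inl
          ⟨x, y, p, r, z, hp, hr, hpo, hxo, hx, hy, hz, rfl, ha', hc'⟩))))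
      · -- W4'
        exact Or.inr (Or.inr (Or.inr (Or.inr (Or.inr (Or.inr (Or.inr (Or.inr
          ⟨u, p, r, z, hp, hr, hu, rfl, ha', hc', hz⟩)))))))
      · -- L2'
        exact Or.inr (Or.inl (Or.inr (Or.inr (Or.inl ⟨u, p, r, z, hp, hr, hu, hz, hze, rfl, ha', hc'⟩))))
  -- three prime powers `a, b ≥ 2`
  have ha2 : 2 ≤ a := by omega
  have hb2 : 2 ≤ b := by omega
  have hnc : ¬ (Nat.Coprime (Nat.log a.minFac a) (Nat.log b.minFac b) ∧
      Nat.Coprime (Nat.log a.minFac a) (Nat.log c.minFac c) ∧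
      Nat.Coprime (Nat.log b.minFac b) (Nat.log c.minFac c)) := fun h => hnr ⟨ha2, hb2, h⟩
  by_cases hev : (2 ∣ Nat.log c.minFac c ∧ (2 ∣ Nat.log a.minFac a ∨ 2 ∣ Nat.log b.minFac b))
  · -- stub 3: even pair through the exponent of `c`
    left
    have := evenPair_le_two_rad a b c ht hω ha2 hb2 hev
    omega
  · -- stub 4: the rest
    rcases threePP_rest a b c ht hω ha2 hb2 hnc hev with h | hL1 | hL1' | hL4 | hL4' | hW3 | hW3'
    · exact Or.inl h
    · exact Or.inr (Or.inl (Or.inl (Or.inl hL1)))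
    · exact Or.inr (Or.inl (Or.inr (Or.inl hL1')))
    · exact Or.inr (Or.inl (Or.inl (Or.inr (Or.inr (Or.inr hL4)))))
    · exact Or.inr (Or.inl (Or.inr (Or.inr (Or.inr (Or.inr hL4')))))
    · exact Or.inr (Or.inr (Or.inl (Or.inr (Or.inr (Or.inr (Or.inr (Or.inl hW3)))))))
    · exact Or.inr (Or.inr (Or.inr (Or.inr (Or.inr (Or.inr (Or.inr (Or.inl hW3')))))))

end Summit.ABC.ABC.Theorems
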